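import Mathlib.MeasureTheory.Function.L2Space
import Mathlib.MeasureTheory.Integral.Prod
import Mathlib.MeasureTheory.Integral.IntervalIntegral.FundThmCalculus
import HarnessLib

/-!
# `L²`-valued paths from pointwise derivatives: Lipschitz bounds and differentiability

Analysis/FunctionSpaces support file (measure theory + one-variable calculus; theorem-only).
When a PDE solution `f(r, x)` is smooth in a parameter `r` *pointwise in `x`*, with
`r`-derivatives that are square integrable in `x` uniformly in `r`, one wants to regard
`r ↦ f(r, ·)` as a differentiable map into `L²(μ)` (e.g. the `r`-slices of a "sufficiently
integrable" function on Kerr, Dafermos–Rodnianski–Shlapentokh-Rothman arXiv:1402.7034 §5.1–5.2,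
where the separated equations are "interpreted in `L²_ω l²_{mℓ}` for each `r`"). This file
proves the two basic facts, for `f, f' : ℝ → X → E` (`E` a complete real normed space) with
`∂_r f(r, x) = f'(r, x)` for every `x` and `f'` jointly (strongly) measurable:

* `sq_intervalIntegral_le` — Cauchy–Schwarz `(∫_a^b φ)² ≤ (b - a) ∫_a^b φ²` and its vector form
  `enorm_sq_intervalIntegral_le` (`‖∫_a^b g‖ₑ² ≤ (b-a) ∫⁻_{(a,b]} ‖g‖ₑ²`);
* `lintegral_enorm_sub_sq_le` (**Lipschitz bound**): if `∫⁻ ‖f'(r, ·)‖ₑ² dμ ≤ C` for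
  `r ∈ [a, b]` then `∫⁻ ‖f(b, ·) - f(a, ·)‖ₑ² dμ ≤ (b - a)² C`; hence `f(b,·) - f(a,·) ∈ L²`,
  `‖[f b] - [f a]‖_{L²} ≤ (b - a) c` for `C = c²`, and `r ↦ [f(r, ·)]` is `c`-Lipschitz, in
  particular continuous, under a uniform bound (`memLp_sub_of_bound`, `norm_toLp_sub_toLp_le`,
  `dist_toLp_le`, `continuous_toLp`);
* `hasDerivAt_toLp` (**differentiability in `L²`**): if moreover every `f(r,·), f'(r,·) ∈ L²`,
  the `L²` norms of `f'(r,·)` are locally bounded and `r ↦ [f'(r,·)] ∈ L²(μ)` is continuous at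
  `r₀`, then `r ↦ [f(r,·)]` has derivative `[f'(r₀,·)]` at `r₀` as an `L²(μ)`-valued map.

Proofs: pointwise fundamental theorem of calculus in `r`, Cauchy–Schwarz on `[a, b]`, and
Tonelli (the `r`-uniform bound makes `f'(·, x)` square integrable on `[a, b]` for a.e. `x`).

## Mathlib / tree search

Mathlib has the pointwise FTC (`intervalIntegral.integral_eq_sub_of_hasDerivAt`), Tonelli
(`lintegral_lintegral_swap`), `hasDerivAt_iff_isLittleO_nhds_zero`, and differentiation of
parametric integrals (the converse direction); no statement turning pointwise-in-`x`
derivatives with `L²` bounds into `L²`-valued derivatives (searched `toLp.*HasDerivAt`,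
`HasDerivAt.*MemLp`, `Lp.*hasDerivAt`).

## References

* M. Dafermos, I. Rodnianski, Y. Shlapentokh-Rothman, arXiv:1402.7034, Def. 5.1.1 and §5.2.3
  ("for each `r` … to be interpreted in `L²_ω l²_{mℓ}`"). [DafermosRodnianskiShlapentokhrothman2014]
-/

noncomputable section

open MeasureTheory Set Filter Topology intervalIntegral
open scoped ENNReal NNReal Interval

namespace Literature.Analysis.FunctionSpaces

/-! ### Cauchy–Schwarz on an interval -/

/-- **Cauchy–Schwarz on `[a, b]`**: `(∫_a^b φ)² ≤ (b - a) ∫_a^b φ²` (via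
`0 ≤ ∫ (φ - mean)²`). [folklore] -/
theorem sq_intervalIntegral_le {φ : ℝ → ℝ} {a b : ℝ} (hab : a ≤ b)
    (h1 : IntervalIntegrable φ volume a b) (h2 : IntervalIntegrable (fun s ↦ φ s ^ 2) volume a b) :
    (∫ s in a..b, φ s) ^ 2 ≤ (b - a) * ∫ s in a..b, φ s ^ 2 := by
  rcases eq_or_lt_of_le hab with h | hlt
  · subst h
    simp
  set L := b - a with hL
  set A := ∫ s in a..b, φ s with hA
  set B := ∫ s in a..b, φ s ^ 2 with hB
  have hLpos : 0 < L := sub_pos.2 hlt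
  have hnn : 0 ≤ ∫ s in a..b, (φ s - A / L) ^ 2 :=
    intervalIntegral.integral_nonneg hab fun s _ ↦ sq_nonneg _
  have hc : IntervalIntegrable (fun _ : ℝ ↦ (A / L) ^ 2) volume a b := intervalIntegrable_const
  have hφc : IntervalIntegrable (fun s ↦ 2 * (A / L) * φ s) volume a b := h1.const_mul _
  have hexp : ∫ s in a..b, (φ s - A / L) ^ 2 = B - A ^ 2 / L := by
    have hfun : (fun s ↦ (φ s - A / L) ^ 2) =
        fun s ↦ φ s ^ 2 - 2 * (A / L) * φ s + (A / L) ^ 2 := by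
      funext s
      ring
    rw [hfun, intervalIntegral.integral_add (h2.sub hφc) hc, intervalIntegral.integral_sub h2 hφc,
      intervalIntegral.integral_const_mul, intervalIntegral.integral_const, smul_eq_mul, ← hA,
      ← hB]
    field_simp
    ring
  rw [hexp] at hnn
  have : A ^ 2 / L ≤ B := by linarith
  rwa [div_le_iff₀ hLpos, mul_comm] at this

variable {E : Type*} [NormedAddCommGroup E] [NormedSpace ℝ E]

/-- **Vector Cauchy–Schwarz on `[a, b]` in `ℝ≥0∞` form**:
`‖∫_a^b g‖ₑ² ≤ (b - a) · ∫⁻_{(a, b]} ‖g‖ₑ²` for an interval-integrable `g` (trivial if the right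
side is infinite). [folklore] -/
theorem enorm_sq_intervalIntegral_le {g : ℝ → E} {a b : ℝ} (hab : a ≤ b)
    (hg : IntervalIntegrable g volume a b) :
    ‖∫ s in a..b, g s‖ₑ ^ 2 ≤ ENNReal.ofReal (b - a) * ∫⁻ s in Ioc a b, ‖g s‖ₑ ^ 2 := by
  by_cases hfin : ∫⁻ s in Ioc a b, ‖g s‖ₑ ^ 2 = ∞
  · rcases eq_or_lt_of_le hab with h | hlt
    · subst h
      simp
    · rw [hfin, ENNReal.mul_top (by simpa using hlt)]
      exact le_top
  -- `‖g‖²` is integrable on `(a, b]`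
  have hmeas : AEStronglyMeasurable (fun s ↦ ‖g s‖ ^ 2) (volume.restrict (Ioc a b)) := by
    have := (hg.1.aestronglyMeasurable.norm.pow 2)
    exact this
  have hint2 : IntegrableOn (fun s ↦ ‖g s‖ ^ 2) (Ioc a b) := by
    refine ⟨hmeas, ?_⟩
    rw [hasFiniteIntegral_iff_enorm]
    have h : ∀ s, ‖‖g s‖ ^ 2‖ₑ = ‖g s‖ₑ ^ 2 := fun s ↦ by
      rw [Real.enorm_eq_ofReal (sq_nonneg _), ← ofReal_norm, ENNReal.ofReal_pow (norm_nonneg _)]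
    simp_rw [h]
    exact lt_top_iff_ne_top.2 hfin
  have hI2 : IntervalIntegrable (fun s ↦ ‖g s‖ ^ 2) volume a b :=
    (intervalIntegrable_iff_integrableOn_Ioc_of_le hab).2 hint2
  -- scalar Cauchy–Schwarz for `φ = ‖g‖`
  have hcs := sq_intervalIntegral_le hab hg.norm hI2
  have h1 : ‖∫ s in a..b, g s‖ ≤ ∫ s in a..b, ‖g s‖ := norm_integral_le_integral_norm hab
  have h0 : 0 ≤ ∫ s in a..b, ‖g s‖ := intervalIntegral.integral_nonneg hab fun s _ ↦ norm_nonneg _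
  have h3 : ‖∫ s in a..b, g s‖ ^ 2 ≤ (b - a) * ∫ s in a..b, ‖g s‖ ^ 2 :=
    (pow_le_pow_left₀ (norm_nonneg _) h1 2).trans hcs
  -- convert to `ℝ≥0∞`
  have h4 : ENNReal.ofReal (∫ s in a..b, ‖g s‖ ^ 2) = ∫⁻ s in Ioc a b, ‖g s‖ₑ ^ 2 := by
    rw [intervalIntegral.integral_of_le hab,
      ofReal_integral_eq_lintegral_ofReal hint2 (ae_of_all _ fun s ↦ sq_nonneg _)]
    refine lintegral_congr fun s ↦ ?_
    rw [← ofReal_norm, ENNReal.ofReal_pow (norm_nonneg _)]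
  calc ‖∫ s in a..b, g s‖ₑ ^ 2 = ENNReal.ofReal (‖∫ s in a..b, g s‖ ^ 2) := by
        rw [← ofReal_norm, ENNReal.ofReal_pow (norm_nonneg _)]
    _ ≤ ENNReal.ofReal ((b - a) * ∫ s in a..b, ‖g s‖ ^ 2) := ENNReal.ofReal_le_ofReal h3
    _ = _ := by rw [ENNReal.ofReal_mul (sub_nonneg.2 hab), h4]

/-! ### The Lipschitz bound -/

variable {X : Type*} [MeasurableSpace X] {μ : Measure X} [SFinite μ]

omit [NormedSpace ℝ E] in
/-- Sections of a jointly strongly measurable `f' : ℝ → X → E` are strongly measurable in `r`.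
[folklore] -/
theorem stronglyMeasurable_section_left {f' : ℝ → X → E}
    (hf' : StronglyMeasurable (Function.uncurry f')) (x : X) :
    StronglyMeasurable fun r ↦ f' r x :=
  hf'.comp_measurable (measurable_id.prodMk measurable_const)

omit [NormedSpace ℝ E] in
/-- From a finite `lintegral` of `‖g‖ₑ²` on `(a, b]` to interval integrability of `g`
(strongly measurable). [folklore] -/
theorem intervalIntegrable_of_lintegral_sq_ne_top {g : ℝ → E} {a b : ℝ} (hab : a ≤ b)
    (hgm : StronglyMeasurable g) (hfin : ∫⁻ s in Ioc a b, ‖g s‖ₑ ^ 2 ≠ ∞) :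
    IntervalIntegrable g volume a b := by
  have hint2 : IntegrableOn (fun s ↦ ‖g s‖ ^ 2) (Ioc a b) := by
    refine ⟨hgm.aestronglyMeasurable.norm.pow 2, ?_⟩
    rw [hasFiniteIntegral_iff_enorm]
    have h : ∀ s, ‖‖g s‖ ^ 2‖ₑ = ‖g s‖ₑ ^ 2 := fun s ↦ by
      rw [Real.enorm_eq_ofReal (sq_nonneg _), ← ofReal_norm,
        ENNReal.ofReal_pow (norm_nonneg _)]
    simp_rw [h]
    exact lt_top_iff_ne_top.2 hfin
  have hmem : MemLp g 2 (volume.restrict (Ioc a b)) :=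
    (memLp_two_iff_integrable_sq_norm hgm.aestronglyMeasurable).2 hint2
  exact (intervalIntegrable_iff_integrableOn_Ioc_of_le hab).2 (hmem.integrable one_le_two)

/-- **The Lipschitz bound**: if `∂_r f(r, x) = f'(r, x)` for all `r` and `x`, `f'` is jointly
strongly measurable and `∫⁻ ‖f'(r, ·)‖ₑ² dμ ≤ C < ∞` for `r ∈ [a, b]`, then
`∫⁻ ‖f(b, ·) - f(a, ·)‖ₑ² dμ ≤ (b - a)² C`. [folklore] -/
theorem lintegral_enorm_sub_sq_le [CompleteSpace E] {f f' : ℝ → X → E} {a b : ℝ} (hab : a ≤ b)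
    (hd : ∀ x r, HasDerivAt (fun r ↦ f r x) (f' r x) r)
    (hf' : StronglyMeasurable (Function.uncurry f')) {C : ℝ≥0∞} (hCtop : C ≠ ∞)
    (hC : ∀ r ∈ Icc a b, ∫⁻ x, ‖f' r x‖ₑ ^ 2 ∂μ ≤ C) :
    ∫⁻ x, ‖f b x - f a x‖ₑ ^ 2 ∂μ ≤ ENNReal.ofReal (b - a) ^ 2 * C := by
  -- joint measurability of `‖f'‖ₑ²` on `ℝ × X`
  have hF : Measurable fun p : ℝ × X ↦ ‖f' p.1 p.2‖ₑ ^ 2 := hf'.enorm.pow_const 2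
  -- Tonelli: `∫_x ∫_{(a,b]} ‖f'‖² = ∫_{(a,b]} ∫_x ‖f'‖² ≤ (b - a) C`
  have hT : ∫⁻ x, (∫⁻ r in Ioc a b, ‖f' r x‖ₑ ^ 2) ∂μ ≤ ENNReal.ofReal (b - a) * C := by
    rw [lintegral_lintegral_swap (f := fun x r ↦ ‖f' r x‖ₑ ^ 2)
      ((hF.comp measurable_swap).aemeasurable)]
    calc ∫⁻ r in Ioc a b, ∫⁻ x, ‖f' r x‖ₑ ^ 2 ∂μ ≤ ∫⁻ _ in Ioc a b, C :=
          setLIntegral_mono measurable_const fun r hr ↦ hC r ⟨hr.1.le, hr.2⟩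
      _ = ENNReal.ofReal (b - a) * C := by
          rw [setLIntegral_const, Real.volume_Ioc, mul_comm]
  have hfin : ∫⁻ x, (∫⁻ r in Ioc a b, ‖f' r x‖ₑ ^ 2) ∂μ ≠ ∞ :=
    ne_top_of_le_ne_top (ENNReal.mul_ne_top ENNReal.ofReal_ne_top hCtop) hT
  -- for a.e. `x` the inner integral is finite, so the pointwise FTC + Cauchy–Schwarz apply
  have hmeasx : Measurable fun x ↦ ∫⁻ r in Ioc a b, ‖f' r x‖ₑ ^ 2 :=
    (hF.comp measurable_swap).lintegral_prod_right'
  have hae : ∀ᵐ x ∂μ, ∫⁻ r in Ioc a b, ‖f' r x‖ₑ ^ 2 < ∞ := ae_lt_top hmeasx hfin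
  have hpt : ∀ᵐ x ∂μ, ‖f b x - f a x‖ₑ ^ 2 ≤
      ENNReal.ofReal (b - a) * ∫⁻ r in Ioc a b, ‖f' r x‖ₑ ^ 2 := by
    filter_upwards [hae] with x hx
    have hgi : IntervalIntegrable (fun r ↦ f' r x) volume a b :=
      intervalIntegrable_of_lintegral_sq_ne_top hab (stronglyMeasurable_section_left hf' x) hx.ne
    rw [← integral_eq_sub_of_hasDerivAt (fun r _ ↦ hd x r) hgi]
    exact enorm_sq_intervalIntegral_le hab hgi
  calc ∫⁻ x, ‖f b x - f a x‖ₑ ^ 2 ∂μ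
      ≤ ∫⁻ x, ENNReal.ofReal (b - a) * (∫⁻ r in Ioc a b, ‖f' r x‖ₑ ^ 2) ∂μ :=
        lintegral_mono_ae hpt
    _ = ENNReal.ofReal (b - a) * ∫⁻ x, (∫⁻ r in Ioc a b, ‖f' r x‖ₑ ^ 2) ∂μ :=
        lintegral_const_mul _ hmeasx
    _ ≤ ENNReal.ofReal (b - a) * (ENNReal.ofReal (b - a) * C) := mul_le_mul_right hT _
    _ = ENNReal.ofReal (b - a) ^ 2 * C := by ring

/-! ### `L²` consequences -/

omit [NormedSpace ℝ E] [SFinite μ] in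
/-- `∫⁻ ‖g‖ₑ² = ‖g‖_{L²}²` (as extended reals). [folklore] -/
theorem lintegral_enorm_sq_eq_eLpNorm_sq (g : X → E) :
    ∫⁻ x, ‖g x‖ₑ ^ 2 ∂μ = eLpNorm g 2 μ ^ 2 := by
  rw [eLpNorm_eq_lintegral_rpow_enorm_toReal two_ne_zero ENNReal.ofNat_ne_top,
    ENNReal.toReal_ofNat, ← ENNReal.rpow_natCast _ 2, ← ENNReal.rpow_mul]
  norm_num

omit [NormedSpace ℝ E] [SFinite μ] in
/-- `‖[g]‖_{L²} ≤ c` from `∫⁻ ‖g‖ₑ² ≤ c²`. [folklore] -/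
theorem norm_toLp_le_of_lintegral_sq_le {g : X → E} (hg : MemLp g 2 μ) {c : ℝ} (hc : 0 ≤ c)
    (h : ∫⁻ x, ‖g x‖ₑ ^ 2 ∂μ ≤ ENNReal.ofReal (c ^ 2)) : ‖hg.toLp g‖ ≤ c := by
  rw [lintegral_enorm_sq_eq_eLpNorm_sq, ENNReal.ofReal_pow hc] at h
  have h1 : eLpNorm g 2 μ ≤ ENNReal.ofReal c := (ENNReal.pow_le_pow_left_iff two_ne_zero).1 h
  rw [Lp.norm_toLp]
  exact (ENNReal.toReal_mono ENNReal.ofReal_ne_top h1).trans_eq (ENNReal.toReal_ofReal hc)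

omit [NormedSpace ℝ E] [SFinite μ] in
/-- `∫⁻ ‖g‖ₑ² ≤ c²` from `‖[g]‖_{L²} ≤ c`. [folklore] -/
theorem lintegral_sq_le_of_norm_toLp_le {g : X → E} (hg : MemLp g 2 μ) {c : ℝ}
    (h : ‖hg.toLp g‖ ≤ c) : ∫⁻ x, ‖g x‖ₑ ^ 2 ∂μ ≤ ENNReal.ofReal (c ^ 2) := by
  have hc : 0 ≤ c := (norm_nonneg _).trans h
  rw [lintegral_enorm_sq_eq_eLpNorm_sq, ENNReal.ofReal_pow hc]
  refine pow_le_pow_left' ?_ 2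
  rw [← ENNReal.ofReal_toReal hg.eLpNorm_ne_top, ← Lp.norm_toLp (hf := hg)]
  exact ENNReal.ofReal_le_ofReal h

/-- Under the hypotheses of `lintegral_enorm_sub_sq_le` with `C = c²`: `f(b,·) - f(a,·) ∈ L²`
as soon as it is a.e. strongly measurable. [folklore] -/
theorem memLp_sub_of_bound [CompleteSpace E] {f f' : ℝ → X → E} {a b : ℝ} (hab : a ≤ b)
    (hd : ∀ x r, HasDerivAt (fun r ↦ f r x) (f' r x) r)
    (hf' : StronglyMeasurable (Function.uncurry f')) {c : ℝ}
    (hC : ∀ r ∈ Icc a b, ∫⁻ x, ‖f' r x‖ₑ ^ 2 ∂μ ≤ ENNReal.ofReal (c ^ 2))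
    (hm : AEStronglyMeasurable (fun x ↦ f b x - f a x) μ) :
    MemLp (fun x ↦ f b x - f a x) 2 μ := by
  refine ⟨hm, ?_⟩
  have h := lintegral_enorm_sub_sq_le (μ := μ) hab hd hf' ENNReal.ofReal_ne_top hC
  rw [lintegral_enorm_sq_eq_eLpNorm_sq] at h
  have hlt : eLpNorm (fun x ↦ f b x - f a x) 2 μ ^ 2 < ∞ :=
    h.trans_lt (ENNReal.mul_lt_top (ENNReal.pow_lt_top ENNReal.ofReal_lt_top)
      ENNReal.ofReal_lt_top)
  refine lt_top_iff_ne_top.2 fun htop ↦ ?_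
  rw [htop, ENNReal.top_pow two_ne_zero] at hlt
  exact lt_irrefl _ hlt

/-- **Lipschitz bound in `L²`**: `‖[f b] - [f a]‖ ≤ (b - a) c` when `∫⁻ ‖f'(r,·)‖ₑ² ≤ c²` on
`[a, b]`. [folklore] -/
theorem norm_toLp_sub_toLp_le [CompleteSpace E] {f f' : ℝ → X → E} {a b : ℝ} (hab : a ≤ b)
    (hd : ∀ x r, HasDerivAt (fun r ↦ f r x) (f' r x) r)
    (hf' : StronglyMeasurable (Function.uncurry f')) {c : ℝ} (hc : 0 ≤ c)
    (hC : ∀ r ∈ Icc a b, ∫⁻ x, ‖f' r x‖ₑ ^ 2 ∂μ ≤ ENNReal.ofReal (c ^ 2))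
    (hfa : MemLp (f a) 2 μ) (hfb : MemLp (f b) 2 μ) :
    ‖hfb.toLp (f b) - hfa.toLp (f a)‖ ≤ (b - a) * c := by
  rw [← MemLp.toLp_sub hfb hfa]
  refine norm_toLp_le_of_lintegral_sq_le _ (mul_nonneg (sub_nonneg.2 hab) hc) ?_
  calc ∫⁻ x, ‖(f b - f a) x‖ₑ ^ 2 ∂μ = ∫⁻ x, ‖f b x - f a x‖ₑ ^ 2 ∂μ := rfl
    _ ≤ ENNReal.ofReal (b - a) ^ 2 * ENNReal.ofReal (c ^ 2) :=
        lintegral_enorm_sub_sq_le hab hd hf' ENNReal.ofReal_ne_top hC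
    _ = ENNReal.ofReal (((b - a) * c) ^ 2) := by
        rw [← ENNReal.ofReal_pow (sub_nonneg.2 hab), ← ENNReal.ofReal_mul (sq_nonneg _)]
        congr 1
        ring

/-- **Global Lipschitz continuity in `L²`** under a uniform bound `∫⁻ ‖f'(r,·)‖ₑ² ≤ c²`.
[folklore] -/
theorem dist_toLp_le [CompleteSpace E] {f f' : ℝ → X → E}
    (hd : ∀ x r, HasDerivAt (fun r ↦ f r x) (f' r x) r)
    (hf' : StronglyMeasurable (Function.uncurry f')) {c : ℝ} (hc : 0 ≤ c)
    (hC : ∀ r, ∫⁻ x, ‖f' r x‖ₑ ^ 2 ∂μ ≤ ENNReal.ofReal (c ^ 2)) (hf : ∀ r, MemLp (f r) 2 μ)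
    (r₁ r₂ : ℝ) : dist ((hf r₁).toLp (f r₁)) ((hf r₂).toLp (f r₂)) ≤ c * |r₁ - r₂| := by
  rcases le_total r₁ r₂ with h | h
  · rw [dist_comm, dist_eq_norm, abs_of_nonpos (sub_nonpos.2 h), neg_sub, mul_comm]
    exact norm_toLp_sub_toLp_le h hd hf' hc (fun r _ ↦ hC r) (hf r₁) (hf r₂)
  · rw [dist_eq_norm, abs_of_nonneg (sub_nonneg.2 h), mul_comm]
    exact norm_toLp_sub_toLp_le h hd hf' hc (fun r _ ↦ hC r) (hf r₂) (hf r₁)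

/-- Hence `r ↦ [f(r, ·)]` is continuous into `L²(μ)`. [folklore] -/
theorem continuous_toLp [CompleteSpace E] {f f' : ℝ → X → E}
    (hd : ∀ x r, HasDerivAt (fun r ↦ f r x) (f' r x) r)
    (hf' : StronglyMeasurable (Function.uncurry f')) {c : ℝ} (hc : 0 ≤ c)
    (hC : ∀ r, ∫⁻ x, ‖f' r x‖ₑ ^ 2 ∂μ ≤ ENNReal.ofReal (c ^ 2)) (hf : ∀ r, MemLp (f r) 2 μ) :
    Continuous fun r ↦ (hf r).toLp (f r) := by
  refine (LipschitzWith.of_dist_le_mul (K := Real.toNNReal c) fun r₁ r₂ ↦ ?_).continuous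
  rw [Real.coe_toNNReal c hc, Real.dist_eq]
  exact dist_toLp_le hd hf' hc hC hf r₁ r₂

/-! ### Differentiability in `L²` -/

omit [NormedSpace ℝ E] in
/-- Unoriented version of `intervalIntegrable_of_lintegral_sq_ne_top`. [folklore] -/
theorem intervalIntegrable_of_lintegral_sq_uIoc_ne_top {g : ℝ → E} {a b : ℝ}
    (hgm : StronglyMeasurable g) (hfin : ∫⁻ s in Ι a b, ‖g s‖ₑ ^ 2 ≠ ∞) :
    IntervalIntegrable g volume a b := by
  rcases le_total a b with hab | hba
  · rw [uIoc_of_le hab] at hfin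
    exact intervalIntegrable_of_lintegral_sq_ne_top hab hgm hfin
  · rw [uIoc_of_ge hba] at hfin
    exact (intervalIntegrable_of_lintegral_sq_ne_top hba hgm hfin).symm

/-- Unoriented vector Cauchy–Schwarz: `‖∫_a^b g‖ₑ² ≤ |b - a| ∫⁻_{Ι a b} ‖g‖ₑ²`. [folklore] -/
theorem enorm_sq_intervalIntegral_le_uIoc {g : ℝ → E} {a b : ℝ}
    (hg : IntervalIntegrable g volume a b) :
    ‖∫ s in a..b, g s‖ₑ ^ 2 ≤ ENNReal.ofReal |b - a| * ∫⁻ s in Ι a b, ‖g s‖ₑ ^ 2 := by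
  rcases le_total a b with hab | hba
  · rw [uIoc_of_le hab, abs_of_nonneg (sub_nonneg.2 hab)]
    exact enorm_sq_intervalIntegral_le hab hg
  · rw [uIoc_of_ge hba, abs_of_nonpos (sub_nonpos.2 hba), neg_sub, integral_symm, enorm_neg]
    exact enorm_sq_intervalIntegral_le hba hg.symm

/-- Pointwise Taylor remainder: `f(r₀ + h) - f(r₀) - h f'(r₀) = ∫_{r₀}^{r₀+h} (f'(s) - f'(r₀)) ds`.
[folklore] -/
theorem sub_sub_smul_eq_integral [CompleteSpace E] {g g' : ℝ → E} {r₀ h : ℝ}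
    (hd : ∀ r, HasDerivAt g (g' r) r) (hi : IntervalIntegrable g' volume r₀ (r₀ + h)) :
    g (r₀ + h) - g r₀ - h • g' r₀ = ∫ s in r₀..r₀ + h, (g' s - g' r₀) := by
  rw [intervalIntegral.integral_sub hi intervalIntegrable_const,
    integral_eq_sub_of_hasDerivAt (fun r _ ↦ hd r) hi, intervalIntegral.integral_const]
  simp

/-- **Differentiability in `L²` from pointwise derivatives.** Let `∂_r f(r, x) = f'(r, x)` for all
`r, x`, with `f'` jointly strongly measurable, every `f(r, ·)` and `f'(r, ·)` in `L²(μ)`, and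
`r ↦ [f'(r, ·)] ∈ L²(μ)` continuous at `r₀`. Then `r ↦ [f(r, ·)]` has derivative `[f'(r₀, ·)]`
at `r₀` as an `L²(μ)`-valued map. [folklore] -/
theorem hasDerivAt_toLp [CompleteSpace E] {f f' : ℝ → X → E} (r₀ : ℝ)
    (hd : ∀ x r, HasDerivAt (fun r ↦ f r x) (f' r x) r)
    (hf' : StronglyMeasurable (Function.uncurry f'))
    (hf : ∀ r, MemLp (f r) 2 μ) (hf'2 : ∀ r, MemLp (f' r) 2 μ)
    (hcont : ContinuousAt (fun r ↦ (hf'2 r).toLp (f' r)) r₀) :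
    HasDerivAt (fun r ↦ (hf r).toLp (f r)) ((hf'2 r₀).toLp (f' r₀)) r₀ := by
  rw [hasDerivAt_iff_isLittleO_nhds_zero, Asymptotics.isLittleO_iff]
  intro ε hε
  -- continuity of `r ↦ [f' r]` at `r₀`, transported to the intervals `uIcc r₀ (r₀ + h)`
  have hev : ∀ᶠ h in 𝓝 (0 : ℝ), ∀ s ∈ uIcc r₀ (r₀ + h),
      ‖(hf'2 s).toLp (f' s) - (hf'2 r₀).toLp (f' r₀)‖ ≤ ε := by
    obtain ⟨δ, hδ, hball⟩ := Metric.eventually_nhds_iff.1 (Metric.tendsto_nhds.1 hcont ε hε)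
    refine Metric.eventually_nhds_iff.2 ⟨δ, hδ, fun h hh s hs ↦ ?_⟩
    have hs' : dist s r₀ < δ := by
      rw [Real.dist_eq] at hh ⊢
      calc |s - r₀| ≤ |r₀ + h - r₀| := abs_sub_left_of_mem_uIcc hs
        _ = |h - 0| := by ring_nf
        _ < δ := hh
    rw [← dist_eq_norm]
    exact (hball hs').le
  filter_upwards [hev] with h hh
  -- the `L²` bound on `f' s - f' r₀` for `s` between `r₀` and `r₀ + h`
  have hG : StronglyMeasurable (Function.uncurry fun s x ↦ f' s x - f' r₀ x) :=
    hf'.sub (hf'.comp_measurable (measurable_const.prodMk measurable_snd))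
  have hGb : ∀ s ∈ Ι r₀ (r₀ + h),
      ∫⁻ x, ‖f' s x - f' r₀ x‖ₑ ^ 2 ∂μ ≤ ENNReal.ofReal (ε ^ 2) := fun s hs ↦ by
    refine lintegral_sq_le_of_norm_toLp_le ((hf'2 s).sub (hf'2 r₀)) ?_
    rw [MemLp.toLp_sub]
    exact hh s (uIoc_subset_uIcc hs)
  -- Tonelli
  have hF : Measurable fun p : ℝ × X ↦ ‖f' p.1 p.2 - f' r₀ p.2‖ₑ ^ 2 := hG.enorm.pow_const 2
  have hT : ∫⁻ x, (∫⁻ s in Ι r₀ (r₀ + h), ‖f' s x - f' r₀ x‖ₑ ^ 2) ∂μ ≤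
      ENNReal.ofReal |h| * ENNReal.ofReal (ε ^ 2) := by
    rw [lintegral_lintegral_swap (f := fun x s ↦ ‖f' s x - f' r₀ x‖ₑ ^ 2)
      ((hF.comp measurable_swap).aemeasurable)]
    calc ∫⁻ s in Ι r₀ (r₀ + h), ∫⁻ x, ‖f' s x - f' r₀ x‖ₑ ^ 2 ∂μ
        ≤ ∫⁻ _ in Ι r₀ (r₀ + h), ENNReal.ofReal (ε ^ 2) := setLIntegral_mono measurable_const hGb
      _ = ENNReal.ofReal |h| * ENNReal.ofReal (ε ^ 2) := by
          rw [setLIntegral_const, Real.volume_uIoc, add_sub_cancel_left, mul_comm]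
  have hfin : ∫⁻ x, (∫⁻ s in Ι r₀ (r₀ + h), ‖f' s x - f' r₀ x‖ₑ ^ 2) ∂μ ≠ ∞ :=
    ne_top_of_le_ne_top (ENNReal.mul_ne_top ENNReal.ofReal_ne_top ENNReal.ofReal_ne_top) hT
  have hmeasx : Measurable fun x ↦ ∫⁻ s in Ι r₀ (r₀ + h), ‖f' s x - f' r₀ x‖ₑ ^ 2 :=
    (hF.comp measurable_swap).lintegral_prod_right'
  have hae : ∀ᵐ x ∂μ, ∫⁻ s in Ι r₀ (r₀ + h), ‖f' s x - f' r₀ x‖ₑ ^ 2 < ∞ := ae_lt_top hmeasx hfin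
  -- pointwise remainder bound
  have hpt : ∀ᵐ x ∂μ, ‖f (r₀ + h) x - f r₀ x - h • f' r₀ x‖ₑ ^ 2 ≤
      ENNReal.ofReal |h| * ∫⁻ s in Ι r₀ (r₀ + h), ‖f' s x - f' r₀ x‖ₑ ^ 2 := by
    filter_upwards [hae] with x hx
    have hGi : IntervalIntegrable (fun s ↦ f' s x - f' r₀ x) volume r₀ (r₀ + h) :=
      intervalIntegrable_of_lintegral_sq_uIoc_ne_top
        (hG.comp_measurable (measurable_id.prodMk measurable_const)) hx.ne
    have hfi : IntervalIntegrable (fun s ↦ f' s x) volume r₀ (r₀ + h) := by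
      have h1 := hGi.add (intervalIntegrable_const (c := f' r₀ x) (μ := volume)
        (a := r₀) (b := r₀ + h))
      simp only [sub_add_cancel] at h1
      exact h1
    rw [sub_sub_smul_eq_integral (hd x) hfi]
    simpa only [add_sub_cancel_left] using enorm_sq_intervalIntegral_le_uIoc hGi
  -- the `L²` remainder
  have hDmem : MemLp (fun x ↦ f (r₀ + h) x - f r₀ x - h • f' r₀ x) 2 μ :=
    ((hf _).sub (hf _)).sub ((hf'2 _).const_smul h)
  have hDeq : (hf (r₀ + h)).toLp (f (r₀ + h)) - (hf r₀).toLp (f r₀) - h • (hf'2 r₀).toLp (f' r₀) =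
      hDmem.toLp _ := by
    refine Lp.ext ?_
    filter_upwards [Lp.coeFn_sub ((hf (r₀ + h)).toLp (f (r₀ + h)) - (hf r₀).toLp (f r₀))
      (h • (hf'2 r₀).toLp (f' r₀)), Lp.coeFn_sub ((hf (r₀ + h)).toLp (f (r₀ + h)))
      ((hf r₀).toLp (f r₀)), Lp.coeFn_smul h ((hf'2 r₀).toLp (f' r₀)), (hf (r₀ + h)).coeFn_toLp,
      (hf r₀).coeFn_toLp, (hf'2 r₀).coeFn_toLp, hDmem.coeFn_toLp] with x h1 h2 h3 h4 h5 h6 h7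
    rw [h7, h1, Pi.sub_apply, h2, h3, Pi.sub_apply, Pi.smul_apply, h4, h5, h6]
  have hDlin : ∫⁻ x, ‖f (r₀ + h) x - f r₀ x - h • f' r₀ x‖ₑ ^ 2 ∂μ ≤
      ENNReal.ofReal ((ε * |h|) ^ 2) := by
    calc ∫⁻ x, ‖f (r₀ + h) x - f r₀ x - h • f' r₀ x‖ₑ ^ 2 ∂μ
        ≤ ∫⁻ x, ENNReal.ofReal |h| * (∫⁻ s in Ι r₀ (r₀ + h), ‖f' s x - f' r₀ x‖ₑ ^ 2) ∂μ :=
          lintegral_mono_ae hpt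
      _ = ENNReal.ofReal |h| * ∫⁻ x, (∫⁻ s in Ι r₀ (r₀ + h), ‖f' s x - f' r₀ x‖ₑ ^ 2) ∂μ :=
          lintegral_const_mul _ hmeasx
      _ ≤ ENNReal.ofReal |h| * (ENNReal.ofReal |h| * ENNReal.ofReal (ε ^ 2)) :=
          mul_le_mul_right hT _
      _ = ENNReal.ofReal ((ε * |h|) ^ 2) := by
          rw [← ENNReal.ofReal_mul (abs_nonneg _), ← ENNReal.ofReal_mul (abs_nonneg _)]
          congr 1
          ring
  have hfinal := norm_toLp_le_of_lintegral_sq_le hDmem (by positivity) hDlin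
  rw [hDeq, Real.norm_eq_abs]
  exact hfinal


end Literature.Analysis.FunctionSpaces
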